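import Literature.GroupTheory.ArithmeticGroups.SL2TwoPowSchurMultiplierAll
import Literature.NumberTheory.Automorphic.UnboundedDenominatorsInvariantHomPrimePower
import HarnessLib

/-!
# The invariant form of CDT Cor. 4.5.3: the local condition at `2` for levels `2^f M`, `f ≥ 3`

Let `N = 2^f M` with `f ≥ 3` and `M` odd, `Q` commutative of exponent `2`, and `θ : Γ(N) → Q` an
`SL₂(ℤ)`-conjugation-invariant homomorphism with `θ(T^N) = 1`.  **Then `θ` kills
`Γ(N) ∩ ([Γ(M), Γ(M)]·K_θ)`** (`local_condition_twoPow`): the central extension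
`Γ(M)/(K_θ ∩ Γ(M)) ↠ SL₂(ℤ/2^f)` has kernel of exponent `2`, the class `t` of `T^{Mu}` (`Mu ≡ 1 mod 2^f`)
lifts `T̄` and `t^{2^f}` is the class of `T^{uN} ∈ K_θ`, so the `2`-adic Schur-multiplier theorem
`SL2TwoPowSchurMultiplierAll.eq_one_of_tau_eq_one` applies.  This is the block certificate at `2^f` needed
for the levels `4 ∣ N` of [CalegariDimitrovTang2025, Corollary 4.5.3]; the hypothesis `θ(T^N) = 1` is
necessary (the Schur multiplier of `SL₂(ℤ/2^f)` is `ℤ/2`, [Beyl1986]) and is arranged in the application by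
passing to a quotient of the target.
-/

open scoped MatrixGroups

namespace Literature.NumberTheory.Automorphic

namespace UnboundedDenominators

open CongruenceSubgroup Matrix.SpecialLinearGroup
open Literature.GroupTheory.ArithmeticGroups

variable {Q : Type*} [CommGroup Q]

/-- `T^N ∈ Γ(N)`. [cite: DiamondShurman2005, §1.2] -/
theorem T_pow_mem_Gamma_self (N : ℕ) : ModularGroup.T ^ N ∈ Gamma N := by
  have := ModularGroup_T_pow_mem_Gamma (N : ℤ) (N : ℤ) (dvd_refl _)
  rwa [zpow_natCast, Int.natAbs_natCast] at this

/-- **The local condition at `2` for `N = 2^f M`, `f ≥ 3`, `M` odd, targets of exponent `2`, under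
`θ(T^N) = 1`.** [cite: CalegariDimitrovTang2025, Corollary 4.5.3] [cite: Beyl1986, Theorem (Schur multiplier
of SL(2,ℤ/m)), 2-primary part] -/
theorem local_condition_twoPow {f M : ℕ} (hf : 3 ≤ f) (hM : Nat.Coprime 2 M)
    (hQ : ∀ q : Q, q ^ 2 = 1) (θ : Gamma (2 ^ f * M) →* Q)
    (hθ : ∀ (g x : SL(2, ℤ)) (hx : x ∈ Gamma (2 ^ f * M)) (hgx : g * x * g⁻¹ ∈ Gamma (2 ^ f * M)),
      θ ⟨g * x * g⁻¹, hgx⟩ = θ ⟨x, hx⟩)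
    (hT : θ ⟨ModularGroup.T ^ (2 ^ f * M), T_pow_mem_Gamma_self _⟩ = 1) :
    ∀ (y : SL(2, ℤ)) (hy : y ∈ Gamma (2 ^ f * M)),
      y ∈ ⁅Gamma M, Gamma M⁆ ⊔ θ.ker.map (Gamma (2 ^ f * M)).subtype → θ ⟨y, hy⟩ = 1 := by
  intro y hy hyc
  haveI : Fact (Nat.Prime 2) := ⟨Nat.prime_two⟩
  have hNM : Gamma (2 ^ f * M) ≤ Gamma M := Wohlfahrt.Gamma_le_Gamma_of_dvd (dvd_mul_left M (2 ^ f))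
  have hNp : Gamma (2 ^ f * M) ≤ Gamma (2 ^ f) := Wohlfahrt.Gamma_le_Gamma_of_dvd (dvd_mul_right (2 ^ f) M)
  have hcopM : (2 ^ f).Coprime M := Nat.Coprime.pow_left f hM
  haveI hKn : (θ.ker.map (Gamma (2 ^ f * M)).subtype).Normal := ker_map_subtype_normal θ hθ
  haveI : ((θ.ker.map (Gamma (2 ^ f * M)).subtype).subgroupOf (Gamma M)).Normal := inferInstance
  -- the reduction and the central extension
  have hK'ρ : (θ.ker.map (Gamma (2 ^ f * M)).subtype).subgroupOf (Gamma M) ≤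
      ((Matrix.SpecialLinearGroup.map (n := Fin 2) (Int.castRingHom (ZMod (2 ^ f)))).comp
        (Gamma M).subtype).ker := by
    intro g hg
    obtain ⟨hgN, -⟩ := (mem_subgroupOf_ker_iff θ g).mp hg
    rw [MonoidHom.mem_ker, MonoidHom.comp_apply, Subgroup.coe_subtype, ← Gamma_mem']
    exact hNp hgN
  let π : Gamma M ⧸ (θ.ker.map (Gamma (2 ^ f * M)).subtype).subgroupOf (Gamma M) →* SL(2, ZMod (2 ^ f)) :=
    QuotientGroup.lift _ _ hK'ρ
  have hπmk : ∀ g : Gamma M, π (QuotientGroup.mk g) =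
      Matrix.SpecialLinearGroup.map (Int.castRingHom (ZMod (2 ^ f))) (g : SL(2, ℤ)) := fun g ↦ rfl
  -- surjective
  have hsurj : Function.Surjective π := by
    intro X
    haveI : NeZero (2 ^ f) := ⟨pow_ne_zero _ two_ne_zero⟩
    obtain ⟨B, hB⟩ :=
      Literature.NumberTheory.EllipticCurves.ModularForms.specialLinearGroup_map_surjective (2 ^ f) X
    obtain ⟨γ, hγ, hγB⟩ := IharaAmalgam.exists_mem_Gamma_forall_dvd_sub hcopM.symm B
    refine ⟨QuotientGroup.mk ⟨γ, hγ⟩, ?_⟩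
    rw [hπmk, ← hB]
    exact map_eq_map_of_forall_dvd_sub (by exact_mod_cast hγB)
  -- kernel elements lie over Γ(N)
  have hkerN : ∀ g : Gamma M, π (QuotientGroup.mk g) = 1 → (g : SL(2, ℤ)) ∈ Gamma (2 ^ f * M) := by
    intro g hg
    rw [hπmk, ← Gamma_mem'] at hg
    exact mem_Gamma_mul_of_coprime hcopM hg g.2
  have hcen : ∀ z, π z = 1 → ∀ g, g * z = z * g := by
    intro z hz g
    induction z using QuotientGroup.induction_on with
    | H x =>
      induction g using QuotientGroup.induction_on with
      | H y =>
        rw [← QuotientGroup.mk_mul, ← QuotientGroup.mk_mul, QuotientGroup.eq]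
        exact comm_mem_subgroupOf_ker θ hθ x y (hkerN x hz)
  have hexp : ∀ z, π z = 1 → z ^ 2 = 1 := by
    intro z hz
    induction z using QuotientGroup.induction_on with
    | H x =>
      rw [← QuotientGroup.mk_pow, QuotientGroup.eq_one_iff]
      exact pow_mem_subgroupOf_ker θ hQ x (hkerN x hz)
  -- the lift `t` of `T̄`: the class of `T^{Mu}` with `Mu ≡ 1 (mod 2^f)`
  obtain ⟨u, -, hu⟩ := Nat.exists_mul_mod_eq_one_of_coprime (Nat.Coprime.pow_left f hM).symm
    (Nat.one_lt_pow (by omega) (by norm_num) : 1 < 2 ^ f)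
  have hMu : ((M * u : ℕ) : ZMod (2 ^ f)) = 1 := by
    rw [← ZMod.natCast_mod, hu, Nat.cast_one]
  have hTMu : ModularGroup.T ^ (M * u) ∈ Gamma M := by
    rw [pow_mul]; exact pow_mem (T_pow_mem_Gamma_self M) u
  set t : Gamma M ⧸ (θ.ker.map (Gamma (2 ^ f * M)).subtype).subgroupOf (Gamma M) :=
    QuotientGroup.mk ⟨ModularGroup.T ^ (M * u), hTMu⟩ with htdef
  have ht : ((π t : SL(2, ZMod (2 ^ f))) : Matrix (Fin 2) (Fin 2) (ZMod (2 ^ f))) = !![1, 1; 0, 1] := by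
    have h1 : π t = (Matrix.SpecialLinearGroup.map (Int.castRingHom (ZMod (2 ^ f))) ModularGroup.T) ^ (M * u) := by
      rw [htdef, hπmk, Subgroup.coe_mk, map_pow]
    rw [h1, SL2TopLayer.tBar_pow _ (SL2TopLayer.coe_map_T (2 ^ f)), hMu]
  have hτ : t ^ 2 ^ f = 1 := by
    rw [htdef, ← QuotientGroup.mk_pow, QuotientGroup.eq_one_iff, mem_subgroupOf_ker_iff]
    have hmem : (((⟨ModularGroup.T ^ (M * u), hTMu⟩ : Gamma M) ^ 2 ^ f : Gamma M) : SL(2, ℤ)) ∈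
        Gamma (2 ^ f * M) := by
      rw [Subgroup.coe_pow, Subgroup.coe_mk, ← pow_mul, show M * u * 2 ^ f = (2 ^ f * M) * u by ring, pow_mul]
      exact pow_mem (T_pow_mem_Gamma_self _) u
    refine ⟨hmem, ?_⟩
    have heq : (⟨(((⟨ModularGroup.T ^ (M * u), hTMu⟩ : Gamma M) ^ 2 ^ f : Gamma M) : SL(2, ℤ)), hmem⟩ :
        Gamma (2 ^ f * M)) = ⟨ModularGroup.T ^ (2 ^ f * M), T_pow_mem_Gamma_self _⟩ ^ u := by
      apply Subtype.ext
      rw [Subgroup.coe_pow, Subgroup.coe_mk, Subgroup.coe_pow, Subgroup.coe_mk, ← pow_mul, ← pow_mul]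
      congr 1; ring
    rw [heq, map_pow, hT, one_pow]
  -- decompose y = c * k
  obtain ⟨c, hc, k, hk, hck⟩ := Subgroup.mem_sup_of_normal_right.mp hyc
  haveI : (Gamma M).Normal := Gamma_normal M
  have hcM : c ∈ Gamma M := (Subgroup.commutator_le_left (Gamma M) (Gamma M)) hc
  obtain ⟨hkN, hk1⟩ := (mem_ker_map_subtype_iff θ).mp hk
  have hkM : k ∈ Gamma M := hNM hkN
  have hyM : y ∈ Gamma M := hNM hy
  have hcls : (QuotientGroup.mk (⟨y, hyM⟩ : Gamma M) :
      Gamma M ⧸ (θ.ker.map (Gamma (2 ^ f * M)).subtype).subgroupOf (Gamma M)) = QuotientGroup.mk ⟨c, hcM⟩ := by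
    have : (⟨y, hyM⟩ : Gamma M) = ⟨c, hcM⟩ * ⟨k, hkM⟩ :=
      Subtype.ext (by rw [Subgroup.coe_mul]; exact hck.symm)
    rw [this, QuotientGroup.mk_mul]
    have hk' : (⟨k, hkM⟩ : Gamma M) ∈ (θ.ker.map (Gamma (2 ^ f * M)).subtype).subgroupOf (Gamma M) :=
      (mem_subgroupOf_ker_iff θ _).mpr ⟨hkN, hk1⟩
    rw [(QuotientGroup.eq_one_iff _).mpr hk', mul_one]
  have hcomm : (QuotientGroup.mk (⟨c, hcM⟩ : Gamma M) :
      Gamma M ⧸ (θ.ker.map (Gamma (2 ^ f * M)).subtype).subgroupOf (Gamma M)) ∈ commutator _ := by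
    have h1 : (⟨c, hcM⟩ : Gamma M) ∈ commutator (Gamma M) := by
      have h2 : (commutator (Gamma M)).map (Gamma M).subtype = ⁅Gamma M, Gamma M⁆ := by
        rw [commutator_def, Subgroup.map_commutator, ← MonoidHom.range_eq_map, Subgroup.range_subtype]
      rw [← h2] at hc
      obtain ⟨c', hc', hcc'⟩ := hc
      have : c' = ⟨c, hcM⟩ := Subtype.ext hcc'
      rwa [this] at hc'
    have := Subgroup.mem_map_of_mem (QuotientGroup.mk' ((θ.ker.map (Gamma (2 ^ f * M)).subtype).subgroupOf
      (Gamma M))) h1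
    rw [commutator_def, Subgroup.map_commutator] at this
    rw [commutator_def]
    exact Subgroup.commutator_mono le_top le_top this
  have hπy : π (QuotientGroup.mk (⟨y, hyM⟩ : Gamma M)) = 1 := by
    rw [hπmk, ← Gamma_mem']
    exact hNp hy
  rw [hcls] at hπy
  have key := SL2TwoPowSchurMultiplierAll.eq_one_of_tau_eq_one f hf π hsurj hcen hexp t ht hτ hπy hcomm
  rw [← hcls, QuotientGroup.eq_one_iff, mem_subgroupOf_ker_iff] at key
  obtain ⟨_, h⟩ := key
  exact h

/-- **Block certificate at `2^f` (`f ≥ 3`) in the shape of `HcorBlocks`** (level `m' * 2^f`), for targets of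
exponent `2` and invariant `θ` with `θ(T^N) = 1`. [cite: CalegariDimitrovTang2025, Corollary 4.5.3] -/
theorem block_certificate_twoPow {f m' : ℕ} (hf : 3 ≤ f) (hm' : m'.Coprime 2) (Q : Type*) [CommGroup Q]
    (hQ : ∀ q : Q, q ^ 2 = 1) (θ : Gamma (m' * 2 ^ f) →* Q)
    (hθ : ∀ (g x : SL(2, ℤ)) (hx : x ∈ Gamma (m' * 2 ^ f)) (hgx : g * x * g⁻¹ ∈ Gamma (m' * 2 ^ f)),
      θ ⟨g * x * g⁻¹, hgx⟩ = θ ⟨x, hx⟩)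
    (hT : θ ⟨ModularGroup.T ^ (m' * 2 ^ f), T_pow_mem_Gamma_self _⟩ = 1) :
    ∀ (y : SL(2, ℤ)) (hy : y ∈ Gamma (m' * 2 ^ f)),
      y ∈ ⁅Gamma m', Gamma m'⁆ ⊔ θ.ker.map (Gamma (m' * 2 ^ f)).subtype → θ ⟨y, hy⟩ = 1 := by
  have h : m' * 2 ^ f = 2 ^ f * m' := mul_comm _ _
  revert θ
  rw [h]
  intro θ hθ hT
  exact local_condition_twoPow hf hm'.symm hQ θ hθ hT

end UnboundedDenominators

end Literature.NumberTheory.Automorphic
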